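import Literature.Computability.AlgebraicComplexity.DDS21TraceBackAssembly
import Literature.Computability.AlgebraicComplexity.DDS21SizeTower
import Literature.Computability.AlgebraicComplexity.UABPDescent
import HarnessLib

/-!
# DDS21 Thm. 3.2 (de-bordering `Σ^{[k]}ΠΣ`): the final assembly — budget absorption and the
# statement of the fact from a DiDIL/trace-back transcript

Theorem-only file (cell `val-lit`, np lane, DDS21 Thm 3.2 programme "M-b", the final assembly of
lead-np RULINGS (136)(c)/(138)(c)). Source: P. Dutta, P. Dwivedi, N. Saxena, *Demystifying the
border of depth-3 algebraic circuits*, FOCS 2021, full version `paper:galaxy-pdf-7641649743695546420`,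
§3, Thm. 3.2 (p0026 L710–717) and "Size blowup" (p0036 L952–961) [DuttaDwivediSaxena2022].

## Contents (all PROVED; 0 definitions, 0 named facts)

* §1 budget absorption: the programme's bricks export ABP budgets of the shape
  `σ₀ ^ (a·(k−1) + b)` with one stage budget `σ₀ ≤ s ^ (c₀ · 7^k)` (DiDIL stage sizes
  `s_j = s^{O(7^j)}`, Claim 3.6; trace-back exponent LINEAR in the number `k − 1` of rounds,
  RULING (138)(a)); `pow_budget_le` / `uabpComputes_absorb` turn this into the fact's
  `s ^ (c · k · 7^k)` with the explicit `c = c₀ · (a + b)`.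
* §2 `DDS2021_thm_3_2_of_pow_budget` / `_of_stage_budget`: the named fact `DDS2021_thm_3_2`
  FOLLOWS from any de-bordering theorem with budget `(s ^ (c₀·7^k)) ^ (a·(k−1)+b)`.
* §3 ★ `DDS2021_thm_3_2_of_transcript`: the named fact from the EXISTENCE OF TRACE-BACK
  TRANSCRIPTS, spelled inline over the field list of the export of record
  `uabpComputes_of_traceBackTranscript_lin'` (t24 g13, `DDS21TraceBackAssembly.lean`, seam
  decision (α′), RULING (144)) with ONE stage budget `σ₀ ≤ s^{c₀·7^{k−1}}`; proof = that theorem +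
  `sigma_one_le_pow` + `stagePow_le_pow` (t18, `DDS21SizeTower.lean`), `c = (c₀ + 2)·2106`. The
  residual gap to `DDS2021_thm_3_2_holds` is exactly this ONE hypothesis (DiDIL step B4b, E2 chain,
  E3 end game, E4 genericity + descent, instantiated through `DDS21TranscriptDilation.lean`).

Honest framing: bookkeeping; `DDS2021_thm_3_2` stays OPEN by name (the hypothesis of §2 is the
whole DiDIL + trace-back pipeline); VP ≠ VNP is NOT proved and nothing here bears on it.

## References

* [DuttaDwivediSaxena2022] P. Dutta, P. Dwivedi, N. Saxena, *Demystifying the border of depth-3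
  algebraic circuits*, Proc. 62nd FOCS (2021), IEEE 2022, 92–103; full version Thm. 3.2
  (p0026 L710–717), Claim 3.6 (p0033 L873–890), "Size blowup" (p0036 L952–961).
-/

noncomputable section

open MvPolynomial
open Literature.RingTheory.MvPolynomial
open scoped BigOperators

namespace Literature.Computability.AlgebraicComplexity

namespace DDS2021

/-! ## §1 Budget absorption: `(s^{c₀·7^k})^{a(k−1)+b} ≤ s^{c₀(a+b)·k·7^k}` -/

section Budget

/-- The exponent bookkeeping of "Size blowup": a stage budget `s^{c₀·7^k}` raised to a power
LINEAR in the number of rounds `k − 1` stays within `s^{c·k·7^k}`, `c = c₀·(a+b)`.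
[cite: DuttaDwivediSaxena2022, §3 proof of Thm. 3.2, "Size blowup" (full version p0036 L952–961)] -/
theorem pow_budget_le {s k c₀ a b : ℕ} (hs : 1 ≤ s) (hk : 1 ≤ k) :
    (s ^ (c₀ * 7 ^ k)) ^ (a * (k - 1) + b) ≤ s ^ (c₀ * (a + b) * k * 7 ^ k) := by
  rw [← pow_mul]
  refine Nat.pow_le_pow_right hs ?_
  have h1 : a * (k - 1) + b ≤ (a + b) * k := by
    have : a * (k - 1) ≤ a * k := Nat.mul_le_mul_left a (Nat.sub_le k 1)
    nlinarith
  calc c₀ * 7 ^ k * (a * (k - 1) + b) ≤ c₀ * 7 ^ k * ((a + b) * k) := Nat.mul_le_mul_left _ h1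
    _ = c₀ * (a + b) * k * 7 ^ k := by ring

/-- Monotone form: any budget `σ₀ ^ X` with `σ₀ ≤ s^{c₀·7^k}` and `X ≤ a·(k−1)+b` is within
`s^{c₀(a+b)·k·7^k}`. [cite: DuttaDwivediSaxena2022, §3 proof of Thm. 3.2, "Size blowup" (full version p0036 L952–961)] -/
theorem pow_budget_le' {s k c₀ a b σ₀ X : ℕ} (hs : 1 ≤ s) (hk : 1 ≤ k) (hσ : σ₀ ≤ s ^ (c₀ * 7 ^ k))
    (hX : X ≤ a * (k - 1) + b) : σ₀ ^ X ≤ s ^ (c₀ * (a + b) * k * 7 ^ k) := by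
  have hσ1 : 1 ≤ s ^ (c₀ * 7 ^ k) := Nat.one_le_pow _ _ hs
  calc σ₀ ^ X ≤ (s ^ (c₀ * 7 ^ k)) ^ X := Nat.pow_le_pow_left hσ X
    _ ≤ (s ^ (c₀ * 7 ^ k)) ^ (a * (k - 1) + b) := Nat.pow_le_pow_right hσ1 hX
    _ ≤ _ := pow_budget_le hs hk

variable {F : Type*} [CommSemiring F] {n : ℕ}

/-- Budget absorption on programs. [cite: DuttaDwivediSaxena2022, §3 proof of Thm. 3.2, "Size blowup" (full version p0036 L952–961)] -/
theorem uabpComputes_absorb {s k c₀ a b σ₀ X : ℕ} {f : MvPolynomial (Fin n) F}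
    (hf : UABPComputes (σ₀ ^ X) f) (hs : 1 ≤ s) (hk : 1 ≤ k) (hσ : σ₀ ≤ s ^ (c₀ * 7 ^ k))
    (hX : X ≤ a * (k - 1) + b) : UABPComputes (s ^ (c₀ * (a + b) * k * 7 ^ k)) f :=
  hf.mono (pow_budget_le' hs hk hσ hX)

end Budget

/-! ## §2 The named fact from a de-bordering theorem with linear-round budget -/

section OfPowBudget

/-- **`DDS2021_thm_3_2` from the assembled pipeline's budget shape.** If every border
`Σ^{[k]}Π^{[d]}Σ` polynomial (budget `s`: `1 ≤ k ≤ s`, `d, n ≤ s`, `2 ≤ s`) has a program within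
`(s^{c₀·7^k})^{a·(k−1)+b}` — the shape delivered by DiDIL (stage sizes `s^{O(7^j)}`, Claim 3.6)
followed by the `k − 1` trace-back rounds (each affine in the previous budget, "Size blowup") —
then the named fact `DDS2021_thm_3_2` holds with `c = c₀·(a+b)`.
[cite: DuttaDwivediSaxena2022, Thm. 3.2 (full version p0026 L710–717); §3 "Size blowup" (p0036 L952–961)] -/
theorem DDS2021_thm_3_2_of_pow_budget {c₀ a b : ℕ}
    (H : ∀ (F : Type) [Field F] [CharZero F] (n k d s : ℕ) (f : MvPolynomial (Fin n) F),
      1 ≤ k → k ≤ s → d ≤ s → n ≤ s → 2 ≤ s →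
        f ∈ border (spsClass (RatFunc F) n k d) →
          UABPComputes ((s ^ (c₀ * 7 ^ k)) ^ (a * (k - 1) + b)) f) :
    DDS2021_thm_3_2 := by
  refine ⟨c₀ * (a + b), fun F _ _ n k d s f hk hks hds hns hs hf => ?_⟩
  exact (H F n k d s f hk hks hds hns hs hf).mono (pow_budget_le (by omega) hk)

/-- Variant with a free stage budget `σ₀ ≤ s^{c₀·7^k}` and exponent `X ≤ a·(k−1)+b` chosen per
instance (the form in which `uabpComputes_of_traceBackTranscript_linear` is applied).
[cite: DuttaDwivediSaxena2022, Thm. 3.2 (full version p0026 L710–717); §3 "Size blowup" (p0036 L952–961)] -/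
theorem DDS2021_thm_3_2_of_stage_budget {c₀ a b : ℕ}
    (H : ∀ (F : Type) [Field F] [CharZero F] (n k d s : ℕ) (f : MvPolynomial (Fin n) F),
      1 ≤ k → k ≤ s → d ≤ s → n ≤ s → 2 ≤ s →
        f ∈ border (spsClass (RatFunc F) n k d) →
          ∃ σ₀ X : ℕ, σ₀ ≤ s ^ (c₀ * 7 ^ k) ∧ X ≤ a * (k - 1) + b ∧ UABPComputes (σ₀ ^ X) f) :
    DDS2021_thm_3_2 := by
  refine ⟨c₀ * (a + b), fun F _ _ n k d s f hk hks hds hns hs hf => ?_⟩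
  obtain ⟨σ₀, X, hσ, hX, hP⟩ := H F n k d s f hk hks hds hns hs hf
  exact uabpComputes_absorb hP (by omega) hk hσ hX

end OfPowBudget

/-! ## §3 ★ `DDS2021_thm_3_2` from the existence of trace-back transcripts (the ONE hypothesis)

The transcript-existence hypothesis is spelled INLINE over the field list of the export of record
`uabpComputes_of_traceBackTranscript_lin'` (t24 g13, `DDS21TraceBackAssembly.lean`; seam decision
(α′), RULING (144)): for every border-`Σ^{[k]}Π^{[d]}Σ` polynomial within budget `s`, a transcript
with `r = k − 1` rounds, precision `D > deg f`, and all programs within ONE stage budget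
`σ₀ ≤ s^{c₀·7^{k−1}}` (DiDIL stage sizes, Claim 3.6). Discharging it is the job of the DiDIL bricks
(B4b step, E2 chain, E3 end game, E4 genericity/descent) through `DDS21TranscriptDilation.lean`. -/

section OfTranscript

/-- Arithmetic: the uniform budget `σ₁ = 3^{k−1}·4·σ₀` of `…_lin'` stays a stage power:
`σ₀ ≤ s^{c₀·7^{k−1}}`, `2 ≤ s`, `1 ≤ k` ⇒ `3^{k−1}·(4·σ₀) ≤ s^{(c₀+2)·7^{k−1}}`.
[cite: DuttaDwivediSaxena2022, §3 proof of Thm. 3.2, "Size blowup" (full version p0036 L952–961)] -/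
theorem sigma_one_le_pow {s k c₀ σ₀ : ℕ} (hs : 2 ≤ s) (hk : 1 ≤ k) (hσ : σ₀ ≤ s ^ (c₀ * 7 ^ (k - 1))) :
    3 ^ (k - 1) * (4 * σ₀) ≤ s ^ ((c₀ + 2) * 7 ^ (k - 1)) := by
  have hs1 : 1 ≤ s := by omega
  have h3 : 3 ^ (k - 1) ≤ s ^ (2 * (k - 1)) := by
    rw [pow_mul]
    exact Nat.pow_le_pow_left (by nlinarith) _
  have h4 : 4 ≤ s ^ 2 := by nlinarith
  have hk7 : k ≤ 7 ^ (k - 1) := by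
    have := Nat.lt_pow_self (by norm_num : 1 < 7) (n := k - 1)
    omega
  calc 3 ^ (k - 1) * (4 * σ₀) ≤ s ^ (2 * (k - 1)) * (s ^ 2 * s ^ (c₀ * 7 ^ (k - 1))) :=
        Nat.mul_le_mul h3 (Nat.mul_le_mul h4 hσ)
    _ = s ^ (2 * (k - 1) + 2 + c₀ * 7 ^ (k - 1)) := by rw [← pow_add, ← pow_add, add_assoc]
    _ ≤ s ^ ((c₀ + 2) * 7 ^ (k - 1)) := Nat.pow_le_pow_right hs1 (by rw [add_mul]; omega)

/-- **★ DDS Thm. 3.2 from the existence of trace-back transcripts.** If for some absolute `c₀`,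
every `f ∈ \overline{Σ^{[k]}Π^{[d]}Σ}` within budget `s` (`1 ≤ k ≤ s`, `d, n ≤ s`, `2 ≤ s`; `F` of
characteristic `0`) admits a trace-back transcript in the sense of
`uabpComputes_of_traceBackTranscript_lin'` — `k − 1` rounds, precision `D` with `deg f < D`,
`k − 1 < D ≤ σ₀`, divisor fractions `A_j/B_j` with nonzero `z = 0` slices `a_j, βn_j`, Claim 3.8
pairs `(Nw_j, ew_j)`, the virtual recursion `N, E` from `N_0 = Φ_α(f)`, `E_0 = 1`, the top
congruence `N_{k−1}·Bt ≡ At·E_{k−1} (mod z^{D−(k−1)})` with `Bt|_{z=0} = βt ≠ 0`, and programs for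
all named polynomials within ONE stage budget `σ₀ ≤ s^{c₀·7^{k−1}}`, `2 ≤ σ₀` — then the named
fact `DDS2021_thm_3_2` holds, with the explicit exponent constant `c = (c₀ + 2)·2106`.
This isolates the DiDIL side (Claims 3.4–3.6, 3.8, genericity of `α`) as ONE hypothesis; the
trace-back (Claims 3.7–3.8, "Size blowup") and the final arithmetic are theorems of the tree.
[cite: DuttaDwivediSaxena2022, Thm. 3.2 (full version p0026 L710–717) and its proof §3 (p0026 L713 – p0036 L964)] -/
theorem DDS2021_thm_3_2_of_transcript
    (H : ∃ c₀ : ℕ, ∀ (F : Type) [Field F] [CharZero F] (n k d s : ℕ) (f : MvPolynomial (Fin n) F),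
      1 ≤ k → k ≤ s → d ≤ s → n ≤ s → 2 ≤ s →
        f ∈ border (spsClass (RatFunc F) n k d) →
          ∃ (D σ₀ : ℕ) (α : Fin n → F) (N E A B : ℕ → MvPolynomial (Fin (n + 1)) F)
            (a βn Nw ew : ℕ → MvPolynomial (Fin n) F) (At Bt : MvPolynomial (Fin (n + 1)) F)
            (βt : MvPolynomial (Fin n) F),
            σ₀ ≤ s ^ (c₀ * 7 ^ (k - 1)) ∧ 2 ≤ σ₀ ∧ f.totalDegree < D ∧ k - 1 < D ∧ D ≤ σ₀ ∧
            N 0 = aeval (fun i : Fin n => (X 0 * X i.succ + C (α i) : MvPolynomial (Fin (n + 1)) F)) f ∧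
            E 0 = 1 ∧
            (∀ j < k - 1, N (j + 1) = pderiv 0 (N j * B j) * (E j * A j) - N j * B j * pderiv 0 (E j * A j)) ∧
            (∀ j < k - 1, E (j + 1) = (E j * A j) ^ 2) ∧
            (∀ j < k - 1, truncDegreeOf 0 1 (A j) = rename Fin.succ (a j) ∧
              truncDegreeOf 0 1 (B j) = rename Fin.succ (βn j) ∧ a j ≠ 0 ∧ βn j ≠ 0 ∧ ew j ≠ 0 ∧
              rename Fin.succ (ew j) * truncDegreeOf 0 1 (N j * B j) =
                rename Fin.succ (Nw j) * truncDegreeOf 0 1 (E j * A j) ∧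
              UABPComputes σ₀ (A j) ∧ UABPComputes σ₀ (B j) ∧ UABPComputes σ₀ (a j) ∧
              UABPComputes σ₀ (βn j) ∧ UABPComputes σ₀ (Nw j) ∧ UABPComputes σ₀ (ew j)) ∧
            truncDegreeOf 0 (D - (k - 1)) (N (k - 1) * Bt) = truncDegreeOf 0 (D - (k - 1)) (At * E (k - 1)) ∧
            truncDegreeOf 0 1 Bt = rename Fin.succ βt ∧ βt ≠ 0 ∧
            UABPComputes σ₀ At ∧ UABPComputes σ₀ Bt ∧ UABPComputes σ₀ βt) :
    DDS2021_thm_3_2 := by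
  obtain ⟨c₀, H⟩ := H
  refine ⟨(c₀ + 2) * 2106, fun F _ _ n k d s f hk hks hds hns hs hf => ?_⟩
  obtain ⟨D, σ₀, α, N, E, A, B, a, βn, Nw, ew, At, Bt, βt, hσs, hσ2, hdeg, hrD, hDσ, hN0, hE0, hNs, hEs,
    hround, htop, hβt, hβt0, hAtP, hBtP, hβtP⟩ := H F n k d s f hk hks hds hns hs hf
  have hσ₁ := sigma_one_le_pow (c₀ := c₀) hs hk hσs
  have hσ01 : σ₀ ≤ 3 ^ (k - 1) * (4 * σ₀) :=
    (show σ₀ ≤ 4 * σ₀ by omega).trans (Nat.le_mul_of_pos_left _ (pow_pos (by norm_num) _))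
  have hlin := uabpComputes_of_traceBackTranscript_lin' (r := k - 1) (d := D) (σ₀ := σ₀)
    (σ₁ := 3 ^ (k - 1) * (4 * σ₀)) f α N E A B a βn Nw ew hN0 hE0 hNs hEs
    (fun j hj => (hround j hj).1) (fun j hj => (hround j hj).2.1) (fun j hj => (hround j hj).2.2.1)
    (fun j hj => (hround j hj).2.2.2.1) (fun j hj => (hround j hj).2.2.2.2.1)
    (fun j hj => (hround j hj).2.2.2.2.2.1) (fun j hj => (hround j hj).2.2.2.2.2.2.1)
    (fun j hj => (hround j hj).2.2.2.2.2.2.2.1) (fun j hj => (hround j hj).2.2.2.2.2.2.2.2.1)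
    (fun j hj => (hround j hj).2.2.2.2.2.2.2.2.2.1) (fun j hj => (hround j hj).2.2.2.2.2.2.2.2.2.2.1)
    (fun j hj => (hround j hj).2.2.2.2.2.2.2.2.2.2.2) htop hβt hβt0 hAtP hBtP hβtP hdeg hrD hDσ hσ2
    hσ01 le_rfl
  refine hlin.mono ((stagePow_le_pow (C := c₀ + 2) (a := 648) (b := 1458) (t := 7)
    (by omega) (by norm_num) hk hσ₁).trans (le_of_eq ?_))
  ring_nf

end OfTranscript

/-! ## §4 ★ The (A′) form: transcripts over the GENERIC-POINT field `F′ = Frac F[y]` suffice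

Architecture (A′) of the cell (RULING (143)(b)): the DiDIL induction is run over
`F′ := FractionRing (MvPolynomial (Fin n) F)` (the random shift `α ∈ Fⁿ` of the print, p0028
L751–754, replaced by the indeterminates `y`), for the base change `map (algebraMap F F′) f`,
and ONE descent step at the end brings the ABP back to `F` with the same budget
(`uabpComputes_descend_fractionRing`, p2 g11, `UABPDescent.lean`). So it suffices that transcripts
exist over `F′` for base-changed inputs. -/

section OfTranscriptFractionRing

/-- `Frac F[y]` has characteristic zero when `F` has. [cite: DuttaDwivediSaxena2022, §2 (full version p0015 L411–413)] -/
theorem charZero_fractionRing_mvPolynomial (F : Type*) [Field F] [CharZero F] (n : ℕ) :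
    CharZero (FractionRing (MvPolynomial (Fin n) F)) :=
  charZero_of_injective_algebraMap
    ((IsFractionRing.injective (MvPolynomial (Fin n) F) (FractionRing (MvPolynomial (Fin n) F))).comp
      (C_injective (Fin n) F) : Function.Injective
        (algebraMap F (FractionRing (MvPolynomial (Fin n) F))))

/-- **★ DDS Thm. 3.2 from transcripts over the generic-point field (architecture (A′)).** As
`DDS2021_thm_3_2_of_transcript`, but the transcript is only required over
`F′ = Frac F[y_1..y_n]` for the base-changed polynomial `map (algebraMap F F′) f` (same budget
parameter `s`, stage bound `σ₀ ≤ s^{c₀·7^{k−1}}`); the conclusion over `F` follows by the descent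
`uabpComputes_descend_fractionRing` ("apply `Φ⁻¹` … the resulting ABP is over `F`").
[cite: DuttaDwivediSaxena2022, Thm. 3.2 (full version p0026 L710–717); §3 proof, "`α_i` are random elements in `F`" (p0028 L751–754) and "apply `Φ^{-1}`" (p0036 L958–962)] -/
theorem DDS2021_thm_3_2_of_transcript_fractionRing
    (H : ∃ c₀ : ℕ, ∀ (F : Type) [Field F] [CharZero F] (n k d s : ℕ) (f : MvPolynomial (Fin n) F),
      1 ≤ k → k ≤ s → d ≤ s → n ≤ s → 2 ≤ s →
        f ∈ border (spsClass (RatFunc F) n k d) →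
          ∃ (D σ₀ : ℕ) (α : Fin n → FractionRing (MvPolynomial (Fin n) F))
            (N E A B : ℕ → MvPolynomial (Fin (n + 1)) (FractionRing (MvPolynomial (Fin n) F)))
            (a βn Nw ew : ℕ → MvPolynomial (Fin n) (FractionRing (MvPolynomial (Fin n) F)))
            (At Bt : MvPolynomial (Fin (n + 1)) (FractionRing (MvPolynomial (Fin n) F)))
            (βt : MvPolynomial (Fin n) (FractionRing (MvPolynomial (Fin n) F))),
            σ₀ ≤ s ^ (c₀ * 7 ^ (k - 1)) ∧ 2 ≤ σ₀ ∧
            (map (algebraMap F (FractionRing (MvPolynomial (Fin n) F))) f).totalDegree < D ∧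
            k - 1 < D ∧ D ≤ σ₀ ∧
            N 0 = aeval (fun i : Fin n => (X 0 * X i.succ + C (α i) :
              MvPolynomial (Fin (n + 1)) (FractionRing (MvPolynomial (Fin n) F))))
                (map (algebraMap F (FractionRing (MvPolynomial (Fin n) F))) f) ∧
            E 0 = 1 ∧
            (∀ j < k - 1, N (j + 1) = pderiv 0 (N j * B j) * (E j * A j) - N j * B j * pderiv 0 (E j * A j)) ∧
            (∀ j < k - 1, E (j + 1) = (E j * A j) ^ 2) ∧
            (∀ j < k - 1, truncDegreeOf 0 1 (A j) = rename Fin.succ (a j) ∧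
              truncDegreeOf 0 1 (B j) = rename Fin.succ (βn j) ∧ a j ≠ 0 ∧ βn j ≠ 0 ∧ ew j ≠ 0 ∧
              rename Fin.succ (ew j) * truncDegreeOf 0 1 (N j * B j) =
                rename Fin.succ (Nw j) * truncDegreeOf 0 1 (E j * A j) ∧
              UABPComputes σ₀ (A j) ∧ UABPComputes σ₀ (B j) ∧ UABPComputes σ₀ (a j) ∧
              UABPComputes σ₀ (βn j) ∧ UABPComputes σ₀ (Nw j) ∧ UABPComputes σ₀ (ew j)) ∧
            truncDegreeOf 0 (D - (k - 1)) (N (k - 1) * Bt) = truncDegreeOf 0 (D - (k - 1)) (At * E (k - 1)) ∧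
            truncDegreeOf 0 1 Bt = rename Fin.succ βt ∧ βt ≠ 0 ∧
            UABPComputes σ₀ At ∧ UABPComputes σ₀ Bt ∧ UABPComputes σ₀ βt) :
    DDS2021_thm_3_2 := by
  obtain ⟨c₀, H⟩ := H
  refine ⟨(c₀ + 2) * 2106, fun F _ _ n k d s f hk hks hds hns hs hf => ?_⟩
  haveI := charZero_fractionRing_mvPolynomial F n
  obtain ⟨D, σ₀, α, N, E, A, B, a, βn, Nw, ew, At, Bt, βt, hσs, hσ2, hdeg, hrD, hDσ, hN0, hE0, hNs, hEs,
    hround, htop, hβt, hβt0, hAtP, hBtP, hβtP⟩ := H F n k d s f hk hks hds hns hs hf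
  have hσ₁ := sigma_one_le_pow (c₀ := c₀) hs hk hσs
  have hσ01 : σ₀ ≤ 3 ^ (k - 1) * (4 * σ₀) :=
    (show σ₀ ≤ 4 * σ₀ by omega).trans (Nat.le_mul_of_pos_left _ (pow_pos (by norm_num) _))
  have hlin := uabpComputes_of_traceBackTranscript_lin' (r := k - 1) (d := D) (σ₀ := σ₀)
    (σ₁ := 3 ^ (k - 1) * (4 * σ₀)) _ α N E A B a βn Nw ew hN0 hE0 hNs hEs
    (fun j hj => (hround j hj).1) (fun j hj => (hround j hj).2.1) (fun j hj => (hround j hj).2.2.1)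
    (fun j hj => (hround j hj).2.2.2.1) (fun j hj => (hround j hj).2.2.2.2.1)
    (fun j hj => (hround j hj).2.2.2.2.2.1) (fun j hj => (hround j hj).2.2.2.2.2.2.1)
    (fun j hj => (hround j hj).2.2.2.2.2.2.2.1) (fun j hj => (hround j hj).2.2.2.2.2.2.2.2.1)
    (fun j hj => (hround j hj).2.2.2.2.2.2.2.2.2.1) (fun j hj => (hround j hj).2.2.2.2.2.2.2.2.2.2.1)
    (fun j hj => (hround j hj).2.2.2.2.2.2.2.2.2.2.2) htop hβt hβt0 hAtP hBtP hβtP hdeg hrD hDσ hσ2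
    hσ01 le_rfl
  refine (uabpComputes_descend_fractionRing f hlin).mono
    ((stagePow_le_pow (C := c₀ + 2) (a := 648) (b := 1458) (t := 7)
      (by omega) (by norm_num) hk hσ₁).trans (le_of_eq ?_))
  ring_nf

end OfTranscriptFractionRing

end DDS2021

end Literature.Computability.AlgebraicComplexity

end
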